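import Summits.HodgeConjecture.HodgeConjecture.Theorems.F0P3cStCharTSHCDescentSemisimpleFinal       -- ★ (F0P3a-p05) the `r = 1∕4` heads; brings ★ Assembly (`skew_rat_smul`, `exists_ratSubmodule_skew`, `isClosed_slice`, `sub_smul_one_mul_sub_smul_one`), ★ file D, ★ E₁∕E₂, ★ (ii-T), ★ (ii-B), ★ D3b, ★ G-FUB, ★ GLOBAL `continuous_charpoly_discr`
import Summits.HodgeConjecture.HodgeConjecture.Theorems.K2E3HCDLieGlobalRpow                         -- ★ (ε4) p856904 (K2E3-p21): pointwise DESCENT `exists_nhds_setLIntegral_eta_rpow_lt_top_traceZero_of_lie`; brings ★ (ε5) `coe_rpow_neg_quarter`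
import Mathlib.Analysis.SpecialFunctions.Pow.Continuity
import HarnessLib

/-!
# K2 · E3 · (SC-an) sub-line «HC-D-ε», file (ε3): SEMISIMPLE DESCENT AT TYPE `(a,a,b)` AT A REAL EXPONENT `r`
# (`ηᵣ X = |disc χ_X|_K^{−r}` is `∫⁻`-finite near every split-semisimple non-scalar point of `𝔲` and of its trace-zero part `𝔲₀`; `2r < 1`, in particular `12 r < 5`)

Cell `pub/hodgecm-mathlib`, crux H413 = `stmt-HodgeConjecture-24833` (lane `--supports … --as helper`); seat K2E5-p15 (g3) (free hand on the HC-D-ε sub-line,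
sub-lead K2E3-p21 (g3), (SC-an) line lead K2E3-p14 (g3), dealer K2E3-plan (g2)).  Exponent-parametric twin of ★ `F0P3cStCharTSHCDescentSemisimpleNormalForm` (E₂ (ii-Q)),
★ `F0P3cStCharTSHCDescentSemisimpleAssembly` (FINAL assembly) and ★ `F0P3cStCharTSHCDescentSemisimpleFinal` (both heads) (F0P3a-p05): there the integrand is frozen at the
road's exponent, `ηι X = (↑√√|disc χ_X|_K)⁻¹ = |disc χ_X|_K^{−1∕4}`; here it is **`ηᵣ X := ((↑|disc χ_X|_K : ℝ≥0∞)) ^ (−r)`** (`ℝ≥0∞`-valued `rpow`, `r : ℝ`), per the SUB-LINE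
CONVENTION v1 of ★ (ε5) `K2E3HCDGroupToLieRpow` (exponent letter `{r : ℝ}` on the `normAbs K`-token; at the `F′`-level the exponent is `s = 2r` on `normAbs F′`; the ★ chain is
`r = 1∕4`).  THEOREMS ONLY (no definition ∕ instance ∕ notation ∕ named fact ∕ `sorry`); ★-only imports (no `Lines`).
HONEST LABEL: count-neutral; closes no organ; HC_CM is proved only modulo the 7 printed citations (2 remaining named inputs: hLiu418 = `stmt-HodgeConjecture-24832`,
h413 = `stmt-HodgeConjecture-24833`) until rung 0 closes; (SC-an) is NOT ★.

THE MATHEMATICS ([HarishChandra1970] Part VII §1 Thm. 15; the semisimple-descent step is Part VI Lemma 22).  The ★ `r = 1∕4` chain is exponent-generic except at ONE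
place: ★ file D `exists_nhds_setLIntegral_lt_top_of_slice` (submersion `V × 𝔠 → 𝔲`) and ★ (ii-T) `exists_ball_setLIntegral_lt_top_iff_conj` (conjugation transport between
centraliser slices) take an OPAQUE measurable class function `η`, so §3 repeats the ★ FINAL assembly word for word with `η = ηᵣ`.  The one real edit is E₂ (§2): on the
centraliser slice `𝔠 ≅ F′² × F′³` of `D = diag(a,a,b)` (★ E₁), ★ file A gives `disc χ_{D+Z} = ι(y ⬝ᵥ B *ᵥ y) · Res(Z)²`, `B = diag(e, −4d′, 4d′e)` non-degenerate, `|Res| ≡ |b − a|²`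
near `0`, so `|disc|_K = |y ⬝ᵥ B *ᵥ y|²_{F′} · |b−a|⁴_K` and (§1) **`ηᵣ(D + Φ(z,y)) = (↑|b−a|⁴_K)^(−r) · (↑|y ⬝ᵥ B *ᵥ y|_{F′})^(−2r)`**; ★ D3b
`forall_exists_nhds_setLIntegral_ternaryQuadraticForm_rpow_neg_lt_top` at `s = 2r < 1` and ★ G-FUB `exists_nhds_setLIntegral_lt_top_of_prod` finish.  §4 HEAD
**`exists_nhds_setLIntegral_eta_rpow_lt_top_of_isSplitSemisimple`** = the first ★ FINAL head with `{r : ℝ} (hr5 : 12 * r < 5)` inserted before `X₀` and the token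
`((↑|disc χ_X|_K)) ^ (−r)` (★ (ii-B) ∘ §3), plus the `r = 1∕4` dictionary check (★ `coe_rpow_neg_quarter`); §5 **`forall_exists_nhds_setLIntegral_eta_rpow_lt_top_traceZero_of_isSplitSemisimple`**
= the second ★ FINAL head at exponent `r` = the `hss` binder of ★ (ε4) `K2E3HCDLieGlobalRpow.forall_exists_nhds_setLIntegral_eta_rpow_lt_top_of_reg_sq_ss` TOKEN FOR TOKEN
(§4 carried to `↥𝔲₀` by ★ (ε4)'s pointwise descent `exists_nhds_setLIntegral_eta_rpow_lt_top_traceZero_of_lie`).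

## References
* [HarishChandra1970] Harish-Chandra (notes by G. van Dijk), *Harmonic Analysis on Reductive p-adic Groups*, LNM 162 (1970), Part VI Lemma 22; Part VII §1 Thm. 15.
* [Rogawski1990] J. D. Rogawski, *Automorphic Representations of Unitary Groups in Three Variables*, Ann. of Math. Stud. 123 (1990), §3.6 pp. 28–31; §12.5 p. 184.
* [Folland1999] G. B. Folland, *Real Analysis* (2nd ed., 1999), §2.5 Thm. 2.37, §11.1 Thm. 11.9.
-/

set_option autoImplicit false
-- the mandated namespace has the single-problem summit's repeated segment (`HodgeConjecture.HodgeConjecture`)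
set_option linter.dupNamespace false

noncomputable section

open MeasureTheory MeasureTheory.Measure Filter Topology Set Matrix Metric Polynomial
open scoped NNReal ENNReal Matrix Matrix.Norms.Elementwise
open Literature.NumberTheory.GaloisRepresentations Literature.NumberTheory.GaloisRepresentations.IsNonarchimedeanLocalField
open Literature.NumberTheory.Automorphic Literature.NumberTheory.Automorphic.LocalFieldHaar
open Literature.MeasureTheory.Group Literature.LinearAlgebra.Matrix
open Summit.HodgeConjecture.HodgeConjecture.Cruxes.H413.F0P3cStCharTSHCDescentSemisimpleAlg
open Summit.HodgeConjecture.HodgeConjecture.Cruxes.H413.F0P3cStCharTSHCDescentSemisimpleCentreCoords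
open Summit.HodgeConjecture.HodgeConjecture.Cruxes.H413.F0P3cStCharTSQuadraticFormNegHalf
open Summit.HodgeConjecture.HodgeConjecture.Cruxes.H413.F0P3cStCharTSHCDescentSemisimpleSliceK
open Summit.HodgeConjecture.HodgeConjecture.Cruxes.H413.F0P3cStCharTSHCDescentSemisimple
open Summit.HodgeConjecture.HodgeConjecture.Cruxes.H413.F0P3cStCharTSHCDescentSemisimpleAssembly
open Summit.HodgeConjecture.HodgeConjecture.Cruxes.H413.F0P3cStCharTSHCDSliceConjTransport
open Summit.HodgeConjecture.HodgeConjecture.Cruxes.H413.F0P3cStCharTSHCDLieGlobal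
open Summit.HodgeConjecture.HodgeConjecture.Cruxes.H413.K2E3HCDGroupToLieRpow
open Summit.HodgeConjecture.HodgeConjecture.Cruxes.H413.K2E3HCDLieGlobalRpow

namespace Summit.HodgeConjecture.HodgeConjecture.Cruxes.H413.K2E3HCDescentSemisimpleRpow

/-! ## §1 `ℝ≥0∞` `rpow` bookkeeping for the token `ηᵣ` -/

/-- `(↑(uⁿ))^s = (↑u)^(n·s)` in `[0, ∞]` for `u : ℝ≥0`. [cite: Folland1999, §2.5 Thm. 2.37] -/
theorem coe_pow_rpow (u : ℝ≥0) (n : ℕ) (s : ℝ) : (((u ^ n : ℝ≥0)) : ℝ≥0∞) ^ s = ((u : ℝ≥0∞)) ^ ((n : ℝ) * s) := by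
  rw [ENNReal.coe_pow, ← ENNReal.rpow_natCast, ← ENNReal.rpow_mul]

/-- **`(↑(u²·v²))^(−r) = (↑(v²))^(−r) · (↑u)^(−2r)`** in `[0, ∞]` for `u v : ℝ≥0` and every real `r` (the `ηᵣ`-analogue of ★ `sqrt_sqrt_sq_mul_sq`:
`|disc|_K = |y ⬝ᵥ B *ᵥ y|²_{F′} · |b − a|⁴_K` ⇒ `ηᵣ = (↑|b − a|⁴)^(−r) · (↑|y ⬝ᵥ B *ᵥ y|_{F′})^(−2r)`). [cite: Folland1999, §2.5 Thm. 2.37] -/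
theorem coe_sq_mul_sq_rpow_neg (u v : ℝ≥0) (r : ℝ) :
    (((u ^ 2 * v ^ 2 : ℝ≥0)) : ℝ≥0∞) ^ (-r) = (((v ^ 2 : ℝ≥0)) : ℝ≥0∞) ^ (-r) * ((u : ℝ≥0∞)) ^ (-(2 * r)) := by
  rw [ENNReal.coe_mul, ENNReal.mul_rpow_of_ne_top ENNReal.coe_ne_top ENNReal.coe_ne_top, mul_comm, coe_pow_rpow u 2 (-r),
    show ((2 : ℕ) : ℝ) * -r = -(2 * r) by push_cast; ring]

/-! ## §2 The centraliser integral in normal form at exponent `r` (twin of ★ E₂ (ii-Q)) -/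

section NormalForm

variable {K : Type*} [Field K] [ValuativeRel K] [TopologicalSpace K] [IsNonarchimedeanLocalField K]
  {F' : Type*} [Field F'] [ValuativeRel F'] [TopologicalSpace F'] [IsNonarchimedeanLocalField F']

/-- **THE CENTRALISER INTEGRAL IN NORMAL FORM AT EXPONENT `r`** (twin of ★ (ii-Q) `exists_nhds_setLIntegral_etaInv_lt_top_normalForm`, its binders VERBATIM + `{r} (h2r : 2r < 1)`):
`σ` a continuous involution of `K` with fixed field `range ι` (`ι : F′ → K` a closed embedding of local fields, norm bridge `|ι x|_K = |x|_{F′}²`), `lam` a skew unit, `2 ≠ 0` in `F′`;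
`J′ = diagonal (ι ∘ d)` (`d i ≠ 0`), `D = diagonal ![a, a, b]` (`a ≠ b`); `𝔠` the `F`-submodule of `J′`-skew matrices commuting with `D` (ANY Borel structure, ANY additive Haar
`μ𝔠`); `μF` any additive Haar measure on `F′`.  Then `ηᵣ(D + Z) = (↑|disc χ_{D+Z}|_K)^(−r)` has finite `∫⁻` on a neighbourhood of `0` in `↥𝔠` (★ E₁ coordinates, ★ file A
factorisation, ★ D3b at `s = 2r`, ★ G-FUB ascent — the ★ proof with the weight exchanged). [cite: HarishChandra1970, Part VI Lemma 22; Part VII §1 Thm. 15] [cite: Rogawski1990, §3.6 pp. 28–31] -/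
theorem exists_nhds_setLIntegral_eta_rpow_lt_top_normalForm
    (σ : K →+* K) (hσ : ∀ x, σ (σ x) = x) (hσc : Continuous σ)
    (ι : F' →+* K) (hι : IsClosedEmbedding ι) (hιr : ∀ x, σ x = x ↔ x ∈ Set.range ι)
    (hιn : ∀ x : F', IsNonarchimedeanLocalField.normAbs K (ι x) = IsNonarchimedeanLocalField.normAbs F' x ^ 2)
    (lam : Kˣ) (hlam : σ lam = -lam) (h2 : (2 : F') ≠ 0)
    (d : Fin 3 → F') (hd : ∀ i, d i ≠ 0) {a b : K} (hab : a ≠ b)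
    {F : Type*} [Field F] [Algebra F K] (𝔠 : Submodule F (Matrix (Fin 3) (Fin 3) K))
    (h𝔠 : ∀ Z, Z ∈ 𝔠 ↔ (Z.map σ)ᵀ * diagonal (fun i => ι (d i)) + diagonal (fun i => ι (d i)) * Z = 0 ∧
      diagonal ![a, a, b] * Z = Z * diagonal ![a, a, b])
    [MeasurableSpace ↥𝔠] [BorelSpace ↥𝔠] (μ𝔠 : Measure ↥𝔠) [μ𝔠.IsAddHaarMeasure]
    [MeasurableSpace F'] [BorelSpace F'] (μF : Measure F') [μF.IsAddHaarMeasure] {r : ℝ} (h2r : 2 * r < 1) :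
    ∃ U ∈ 𝓝 (0 : ↥𝔠), ∫⁻ Z in U,
      ((IsNonarchimedeanLocalField.normAbs K
        (Matrix.charpoly (diagonal ![a, a, b] + (Z : Matrix (Fin 3) (Fin 3) K))).discr : ℝ≥0∞)) ^ (-r) ∂μ𝔠 < ∞ := by
  haveI : SecondCountableTopology F' := secondCountableTopology_localField F'
  haveI : SecondCountableTopology K := secondCountableTopology_localField K
  have h2K : (2 : K) ≠ 0 := by rw [← map_ofNat ι 2]; exact (map_ne_zero ι).2 h2
  have h4 : (4 : F') ≠ 0 := by
    rw [show (4 : F') = 2 * 2 by norm_num]; exact mul_ne_zero h2 h2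
  haveI : T2Space F' := (IsNonarchimedeanLocalField.isLocalField F').toT2Space
  -- coordinates (★ E₁), on the additive subgroup underlying `𝔠` (same subtype)
  obtain ⟨Φ₀, hΦ₀⟩ := exists_coords_centraliser σ hσ hσc ι hι hιr lam hlam h2K d hd hab 𝔠.toAddSubgroup (fun Z => h𝔠 Z)
  let Φ : ((Fin 2 → F') × (Fin 3 → F')) ≃ₜ+ ↥𝔠 := Φ₀
  have hΦ : ∀ p : (Fin 2 → F') × (Fin 3 → F'),
      ((Φ p : ↥𝔠) : Matrix (Fin 3) (Fin 3) K) 0 0 = lam * ι (p.2 0 + p.1 0) ∧ ((Φ p : ↥𝔠) : Matrix (Fin 3) (Fin 3) K) 0 1 = ι (p.2 1) + lam * ι (p.2 2) ∧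
      ((Φ p : ↥𝔠) : Matrix (Fin 3) (Fin 3) K) 1 0 = -(ι (d 0 / d 1) * (ι (p.2 1) - lam * ι (p.2 2))) ∧ ((Φ p : ↥𝔠) : Matrix (Fin 3) (Fin 3) K) 1 1 = lam * ι (p.1 0) ∧
      ((Φ p : ↥𝔠) : Matrix (Fin 3) (Fin 3) K) 2 2 = lam * ι (p.1 1) ∧ ((Φ p : ↥𝔠) : Matrix (Fin 3) (Fin 3) K) 0 2 = 0 ∧ ((Φ p : ↥𝔠) : Matrix (Fin 3) (Fin 3) K) 1 2 = 0 ∧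
      ((Φ p : ↥𝔠) : Matrix (Fin 3) (Fin 3) K) 2 0 = 0 ∧ ((Φ p : ↥𝔠) : Matrix (Fin 3) (Fin 3) K) 2 1 = 0 := hΦ₀
  -- `lam² = ι e`
  obtain ⟨e, he⟩ : ∃ e : F', ι e = (lam : K) ^ 2 := by
    obtain ⟨e, he⟩ := (hιr ((lam : K) ^ 2)).1 (by rw [map_pow, hlam, neg_sq])
    exact ⟨e, he⟩
  have he0 : e ≠ 0 := by
    intro h; rw [h, map_zero] at he; exact pow_ne_zero 2 lam.ne_zero he.symm
  have hd' : d 0 / d 1 ≠ 0 := div_ne_zero (hd 0) (hd 1)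
  -- the ternary form
  set B : Matrix (Fin 3) (Fin 3) F' := diagonal ![e, -4 * (d 0 / d 1), 4 * (d 0 / d 1) * e] with hB
  have hBs : B.IsSymm := Matrix.isSymm_diagonal _
  have hBd : B.det ≠ 0 := by
    rw [hB, det_diagonal, Fin.prod_univ_three]
    simp only [Matrix.cons_val_zero, Matrix.cons_val_one, Matrix.head_cons, Matrix.cons_val_two, Matrix.tail_cons]
    exact mul_ne_zero (mul_ne_zero he0 (mul_ne_zero (neg_ne_zero.2 h4) hd')) (mul_ne_zero (mul_ne_zero h4 hd') he0)
  have hQ : ∀ y : Fin 3 → F', y ⬝ᵥ B *ᵥ y = e * y 0 ^ 2 + -4 * (d 0 / d 1) * y 1 ^ 2 + 4 * (d 0 / d 1) * e * y 2 ^ 2 := fun y => by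
    rw [hB, dotProduct, Fin.sum_univ_three]
    simp only [mulVec_diagonal, Matrix.cons_val_zero, Matrix.cons_val_one, Matrix.head_cons, Matrix.cons_val_two, Matrix.tail_cons]
    ring
  -- the `q`-factor in coordinates
  have hq : ∀ p : (Fin 2 → F') × (Fin 3 → F'),
      (((Φ p : ↥𝔠) : Matrix (Fin 3) (Fin 3) K) 0 0 - ((Φ p : ↥𝔠) : Matrix (Fin 3) (Fin 3) K) 1 1) ^ 2 +
        4 * (((Φ p : ↥𝔠) : Matrix (Fin 3) (Fin 3) K) 0 1 * ((Φ p : ↥𝔠) : Matrix (Fin 3) (Fin 3) K) 1 0) = ι (p.2 ⬝ᵥ B *ᵥ p.2) := by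
    intro p
    obtain ⟨h00, h01, h10, h11, -, -, -, -, -⟩ := hΦ p
    rw [h00, h01, h10, h11, hQ]
    simp only [map_add, map_mul, map_neg, map_pow, map_ofNat]
    linear_combination (-(ι (p.2 0)) ^ 2 - 4 * ι (d 0 / d 1) * ι (p.2 2) ^ 2) * he
  -- the resultant factor and its constancy neighbourhood
  set R : Matrix (Fin 3) (Fin 3) K → K := fun Z => (b + Z 2 2 - a - Z 0 0) * (b + Z 2 2 - a - Z 1 1) - Z 0 1 * Z 1 0 with hR
  have hR0 : R 0 = (b - a) ^ 2 := by simp only [hR, Matrix.zero_apply]; ring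
  have hRc : Continuous fun Z : ↥𝔠 => R (Z : Matrix (Fin 3) (Fin 3) K) := by
    have hent : ∀ i j, Continuous fun X : ↥𝔠 => (X : Matrix (Fin 3) (Fin 3) K) i j :=
      fun i j => (continuous_apply j).comp ((continuous_apply i).comp continuous_subtype_val)
    exact ((((continuous_const.add (hent 2 2)).sub continuous_const).sub (hent 0 0)).mul
      (((continuous_const.add (hent 2 2)).sub continuous_const).sub (hent 1 1))).sub ((hent 0 1).mul (hent 1 0))
  have hρ0 : IsNonarchimedeanLocalField.normAbs K ((b - a) ^ 2) ≠ 0 := by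
    rw [_root_.map_ne_zero]; exact pow_ne_zero 2 (sub_ne_zero.2 (Ne.symm hab))
  set N₀ : Set ↥𝔠 := {Z | IsNonarchimedeanLocalField.normAbs K (R (Z : Matrix (Fin 3) (Fin 3) K) - (b - a) ^ 2) <
    IsNonarchimedeanLocalField.normAbs K ((b - a) ^ 2)} with hN₀
  have hN₀o : IsOpen N₀ := isOpen_lt (continuous_normAbs.comp (hRc.sub continuous_const)) continuous_const
  have h0N₀ : (0 : ↥𝔠) ∈ N₀ := by
    show IsNonarchimedeanLocalField.normAbs K (R ((0 : ↥𝔠) : Matrix (Fin 3) (Fin 3) K) - (b - a) ^ 2) < _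
    rw [ZeroMemClass.coe_zero, hR0, sub_self, map_zero]
    exact pos_iff_ne_zero.2 hρ0
  have hRN : ∀ Z ∈ N₀, IsNonarchimedeanLocalField.normAbs K (R (Z : Matrix (Fin 3) (Fin 3) K)) = IsNonarchimedeanLocalField.normAbs K ((b - a) ^ 2) := by
    intro Z hZ
    have h := normAbs_add_eq_of_lt hZ
    rwa [add_sub_cancel] at h
  -- the model integrand on `F′³` (exponent `2r` on `normAbs F′`) and its transport
  set g : (Fin 3 → F') → ℝ≥0∞ := fun y =>
    (((IsNonarchimedeanLocalField.normAbs K ((b - a) ^ 2) ^ 2 : ℝ≥0)) : ℝ≥0∞) ^ (-r) *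
      ((IsNonarchimedeanLocalField.normAbs F' (y ⬝ᵥ B *ᵥ y) : ℝ≥0∞)) ^ (-(2 * r)) with hg
  have hQc : Continuous fun y : Fin 3 → F' => y ⬝ᵥ B *ᵥ y := by
    simp only [hQ]; fun_prop
  have hFm : Measurable fun y : Fin 3 → F' => ((IsNonarchimedeanLocalField.normAbs F' (y ⬝ᵥ B *ᵥ y) : ℝ≥0∞)) ^ (-(2 * r)) :=
    (ENNReal.continuous_rpow_const.comp (ENNReal.continuous_coe.comp (continuous_normAbs.comp hQc))).measurable
  have hgm : Measurable g := hFm.const_mul _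
  set f : ↥𝔠 → ℝ≥0∞ := fun Z => g (Φ.symm Z).2 with hf
  have hfg : ∀ (z : Fin 2 → F') (y : Fin 3 → F'), f (Φ (z, y)) = g y := fun z y => by
    simp only [hf, ContinuousAddEquiv.symm_apply_apply]
  -- ★ D3b at `y = 0`, exponent `s = 2r < 1`
  obtain ⟨U₃, hU₃, hU₃i⟩ := forall_exists_nhds_setLIntegral_ternaryQuadraticForm_rpow_neg_lt_top μF hBs hBd h2 (s := 2 * r) h2r 0
  have hU₃g : ∫⁻ y in U₃, g y ∂(Measure.pi fun _ : Fin 3 => μF) < ∞ := by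
    simp only [hg]
    rw [lintegral_const_mul _ hFm]
    refine ENNReal.mul_lt_top (lt_top_iff_ne_top.2 (ENNReal.rpow_ne_top_of_ne_zero ?_ ENNReal.coe_ne_top)) hU₃i
    exact_mod_cast pow_ne_zero 2 hρ0
  -- ascend along `Φ` (★ G-FUB; any Haar measure on `↥𝔠`)
  haveI : LocallyCompactSpace ↥𝔠 := Φ.toHomeomorph.symm.isClosedEmbedding.locallyCompactSpace
  haveI : SecondCountableTopology ↥𝔠 := Φ.toHomeomorph.symm.secondCountableTopology
  obtain ⟨U, hU, hUi⟩ := exists_nhds_setLIntegral_lt_top_of_prod Φ (Measure.pi fun _ : Fin 3 => μF) μ𝔠 (Measure.pi fun _ : Fin 2 => μF) hgm hfg 0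
    ⟨U₃, hU₃, hU₃g⟩
  rw [show ((0 : Fin 2 → F'), (0 : Fin 3 → F')) = 0 from rfl, map_zero] at hU
  obtain ⟨O, hOU, hOo, h0O⟩ := mem_nhds_iff.1 hU
  refine ⟨O ∩ N₀, inter_mem (hOo.mem_nhds h0O) (hN₀o.mem_nhds h0N₀), ?_⟩
  -- on `N₀` the integrand IS `f`
  have hpt : ∀ Z ∈ O ∩ N₀,
      ((IsNonarchimedeanLocalField.normAbs K
        (Matrix.charpoly (diagonal ![a, a, b] + (Z : Matrix (Fin 3) (Fin 3) K))).discr : ℝ≥0∞)) ^ (-r) = f Z := by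
    intro Z hZ
    set p := Φ.symm Z with hp
    have hZp : Z = Φ p := (Φ.apply_symm_apply Z).symm
    obtain ⟨-, -, -, -, -, h02, h12, h20, h21⟩ := hΦ p
    have hdisc : (Matrix.charpoly (diagonal ![a, a, b] + (Z : Matrix (Fin 3) (Fin 3) K))).discr =
        ι (p.2 ⬝ᵥ B *ᵥ p.2) * R (Z : Matrix (Fin 3) (Fin 3) K) ^ 2 := by
      rw [hZp, discr_charpoly_diagonal_add_of_commute a b _ h02 h12 h20 h21, hq p]
    have hval : IsNonarchimedeanLocalField.normAbs K (Matrix.charpoly (diagonal ![a, a, b] + (Z : Matrix (Fin 3) (Fin 3) K))).discr =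
        IsNonarchimedeanLocalField.normAbs F' (p.2 ⬝ᵥ B *ᵥ p.2) ^ 2 * IsNonarchimedeanLocalField.normAbs K ((b - a) ^ 2) ^ 2 := by
      rw [hdisc, map_mul, map_pow, hιn, hRN Z hZ.2]
    rw [hval, coe_sq_mul_sq_rpow_neg]
  rw [setLIntegral_congr_fun (hOo.inter hN₀o).measurableSet hpt]
  exact lt_of_le_of_lt (lintegral_mono_set (inter_subset_left.trans hOU)) hUi

end NormalForm

/-! ## §3 The assembly on `↥𝔲` at exponent `r` (twin of ★ FINAL assembly `…_of_normalFormBasis`); §4–§5 the heads -/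

section Assembly

variable {K : Type*} [Field K] [ValuativeRel K] [TopologicalSpace K] [IsNonarchimedeanLocalField K] [CharZero K]

/-- **SEMISIMPLE DESCENT AT TYPE `(a,a,b)` AT EXPONENT `r`, GIVEN A NORMAL-FORM BASIS** (twin of ★ `exists_nhds_setLIntegral_etaInv_lt_top_of_normalFormBasis`, its binders
VERBATIM + `{r} (hr5 : 12 r < 5)` before `X₀`; only `2r < 1` is used).  Road frame: `σ` a continuous involution of the char-0 non-archimedean local field `K` whose fixed field is
the closed-embedded local field `ι : F′ → K` (norm bridge `|ι x|_K = |x|²_{F′}`), `lam` a skew unit, `2 ≠ 0`; `det J` a unit; `𝔲 = 𝔲(J)` with ANY Borel structure and ANY additive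
Haar `μ`.  If `X₀ ∈ 𝔲` satisfies `(X₀ − a)(X₀ − b) = 0`, `a ≠ b`, and admits a normal-form basis `g` (`det g` a unit, `g⁻¹ X₀ g = diagonal ![a, a, b]`, `ᵗ(σ g) J g = diagonal d`,
`σ dᵢ = dᵢ ≠ 0`), then `ηᵣ X = (↑|disc χ_X|_K)^(−r)` has finite `∫⁻` near `X₀` in `↥𝔲` — the ★ assembly verbatim with the opaque class function `η := ηᵣ` (★ file D, ★ (ii-T), §2).
[cite: HarishChandra1970, Part VI Lemma 22; Part VII §1 Thm. 15] [cite: Rogawski1990, §3.6 pp. 28–31; §12.5 p. 184] [cite: Folland1999, §11.1 Thm. 11.9] -/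
theorem exists_nhds_setLIntegral_eta_rpow_lt_top_of_normalFormBasis
    (σ : K →+* K) (hσ : ∀ x, σ (σ x) = x) (hσc : Continuous σ)
    {J : Matrix (Fin 3) (Fin 3) K} (hJd : IsUnit J.det) (h2 : (2 : K) ≠ 0)
    (lam : Kˣ) (hlam : σ (lam : K) = -(lam : K))
    (𝔲 : AddSubgroup (Matrix (Fin 3) (Fin 3) K)) (h𝔲 : ∀ X, X ∈ 𝔲 ↔ (X.map σ)ᵀ * J + J * X = 0)
    [MeasurableSpace ↥𝔲] [BorelSpace ↥𝔲] (μ : Measure ↥𝔲) [μ.IsAddHaarMeasure]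
    {F' : Type*} [Field F'] [ValuativeRel F'] [TopologicalSpace F'] [IsNonarchimedeanLocalField F']
    (ι : F' →+* K) (hι : IsClosedEmbedding ι) (hιr : ∀ x, σ x = x ↔ x ∈ Set.range ι)
    (hιn : ∀ x : F', IsNonarchimedeanLocalField.normAbs K (ι x) = IsNonarchimedeanLocalField.normAbs F' x ^ 2)
    {r : ℝ} (hr5 : 12 * r < 5)
    (X₀ : ↥𝔲) {a b : K} (hab : a ≠ b)
    (hmin : ((X₀ : Matrix (Fin 3) (Fin 3) K) - a • (1 : Matrix (Fin 3) (Fin 3) K)) * ((X₀ : Matrix (Fin 3) (Fin 3) K) - b • 1) = 0)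
    {g : Matrix (Fin 3) (Fin 3) K} (hg : IsUnit g.det) (hgX : g⁻¹ * (X₀ : Matrix (Fin 3) (Fin 3) K) * g = diagonal ![a, a, b])
    {d : Fin 3 → K} (hd : ∀ i, σ (d i) = d i ∧ d i ≠ 0) (hgJ : (g.map σ)ᵀ * J * g = diagonal d) :
    ∃ U ∈ 𝓝 X₀, ∫⁻ X in U,
      ((IsNonarchimedeanLocalField.normAbs K (Matrix.charpoly (X : Matrix (Fin 3) (Fin 3) K)).discr : ℝ≥0∞)) ^ (-r) ∂μ < ∞ := by
  classical
  have h2r : 2 * r < 1 := by linarith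
  -- the `K`-façade (topology `rfl`-equal to the given one) and the Borel structures
  letI : NontriviallyNormedField K := nontriviallyNormedField K
  haveI : CompleteSpace K := completeSpace_nontriviallyNormedField K
  haveI : IsUltrametricDist K := isUltrametricDist_nontriviallyNormedField K
  haveI : ProperSpace K := ProperSpace.of_nontriviallyNormedField_of_weaklyLocallyCompactSpace K
  haveI : SecondCountableTopology K := secondCountableTopology_localField K
  haveI : SecondCountableTopology F' := secondCountableTopology_localField F'
  haveI : T2Space F' := (IsNonarchimedeanLocalField.isLocalField F').toT2Space
  haveI : SecondCountableTopology (Matrix (Fin 3) (Fin 3) K) := inferInstanceAs (SecondCountableTopology (Fin 3 → Fin 3 → K))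
  haveI : LocallyCompactSpace (Matrix (Fin 3) (Fin 3) K) := inferInstanceAs (LocallyCompactSpace (Fin 3 → Fin 3 → K))
  letI : MeasurableSpace (Matrix (Fin 3) (Fin 3) K) := borel _
  haveI : BorelSpace (Matrix (Fin 3) (Fin 3) K) := ⟨rfl⟩
  letI : MeasurableSpace F' := borel F'
  haveI : BorelSpace F' := ⟨rfl⟩
  -- the integrand as an opaque class function
  obtain ⟨η, hη⟩ : ∃ η : Matrix (Fin 3) (Fin 3) K → ℝ≥0∞, ∀ X, η X =
      ((IsNonarchimedeanLocalField.normAbs K (Matrix.charpoly X).discr : ℝ≥0∞)) ^ (-r) := ⟨_, fun _ => rfl⟩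
  have hηeq : η = fun X => ((IsNonarchimedeanLocalField.normAbs K (Matrix.charpoly X).discr : ℝ≥0∞)) ^ (-r) := funext hη
  have hgm : Measurable η := by
    rw [hηeq]
    exact (ENNReal.continuous_rpow_const.comp (ENNReal.continuous_coe.comp (continuous_normAbs.comp continuous_charpoly_discr))).measurable
  have hclass : ∀ X Y : Matrix (Fin 3) (Fin 3) K, X.charpoly = Y.charpoly → η X = η Y := fun X Y h => by rw [hη, hη, h]
  -- `𝔲` as a `ℚ`-submodule (same subtype), the normal-form skew submodule `𝔲'`
  have hS : ((X₀ : Matrix (Fin 3) (Fin 3) K).map σ)ᵀ * J + J * (X₀ : Matrix (Fin 3) (Fin 3) K) = 0 := (h𝔲 _).1 X₀.2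
  let 𝔲ℚ : Submodule ℚ (Matrix (Fin 3) (Fin 3) K) :=
    { carrier := 𝔲, zero_mem' := 𝔲.zero_mem, add_mem' := 𝔲.add_mem, smul_mem' := fun c X hX => (h𝔲 _).2 (skew_rat_smul σ J c ((h𝔲 X).1 hX)) }
  have h𝔲ℚ : ∀ X, X ∈ 𝔲ℚ ↔ (X.map σ)ᵀ * J + J * X = 0 := fun X => h𝔲 X
  obtain ⟨𝔲', h𝔲'⟩ := exists_ratSubmodule_skew σ ((g.map σ)ᵀ * J * g)
  -- Haar measures on the two centraliser slices and on `F′`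
  haveI := (isClosed_slice hσc J (X₀ : Matrix (Fin 3) (Fin 3) K) 𝔲ℚ h𝔲ℚ).locallyCompactSpace
  haveI := (isClosed_slice hσc ((g.map σ)ᵀ * J * g) (g⁻¹ * (X₀ : Matrix (Fin 3) (Fin 3) K) * g) 𝔲' h𝔲').locallyCompactSpace
  haveI : SecondCountableTopology ↥(𝔲' ⊓ (LinearMap.ker (LinearMap.mulLeft K (g⁻¹ * (X₀ : Matrix (Fin 3) (Fin 3) K) * g) -
      LinearMap.mulRight K (g⁻¹ * (X₀ : Matrix (Fin 3) (Fin 3) K) * g) : Module.End K (Matrix (Fin 3) (Fin 3) K))).restrictScalars ℚ) :=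
    TopologicalSpace.Subtype.secondCountableTopology _
  let μ𝔠 : Measure ↥(𝔲ℚ ⊓ (LinearMap.ker (LinearMap.mulLeft K (X₀ : Matrix (Fin 3) (Fin 3) K) - LinearMap.mulRight K (X₀ : Matrix (Fin 3) (Fin 3) K) :
      Module.End K (Matrix (Fin 3) (Fin 3) K))).restrictScalars ℚ) := Measure.addHaar
  let μ𝔠' : Measure ↥(𝔲' ⊓ (LinearMap.ker (LinearMap.mulLeft K (g⁻¹ * (X₀ : Matrix (Fin 3) (Fin 3) K) * g) -
      LinearMap.mulRight K (g⁻¹ * (X₀ : Matrix (Fin 3) (Fin 3) K) * g) : Module.End K (Matrix (Fin 3) (Fin 3) K))).restrictScalars ℚ) := Measure.addHaar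
  let μF : Measure F' := Measure.addHaar
  -- the separable polynomial `(X − a)(X − b)` kills `X₀`
  have hp : ((X - C a) * (X - C b) : K[X]).Separable :=
    separable_X_sub_C.mul separable_X_sub_C (isCoprime_X_sub_C_of_isUnit_sub (sub_ne_zero.2 hab).isUnit)
  have hpS : aeval (X₀ : Matrix (Fin 3) (Fin 3) K) ((X - C a) * (X - C b) : K[X]) = 0 := by
    rw [map_mul, map_sub, map_sub, aeval_X, aeval_C, aeval_C, Algebra.algebraMap_eq_smul_one, Algebra.algebraMap_eq_smul_one]
    exact hmin
  -- §2 on the normal-form slice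
  have h2F : (2 : F') ≠ 0 := fun h => h2 (by rw [← map_ofNat ι 2, h, map_zero])
  choose d' hd' using fun i => (hιr (d i)).1 (hd i).1
  have hd'0 : ∀ i, d' i ≠ 0 := fun i h => (hd i).2 (by rw [← hd' i, h, map_zero])
  have hJ'd : (g.map σ)ᵀ * J * g = diagonal (fun i => ι (d' i)) := by
    rw [hgJ]; congr 1; funext i; rw [hd']
  have h𝔠T : ∀ Z, Z ∈ (𝔲' ⊓ (LinearMap.ker (LinearMap.mulLeft K (g⁻¹ * (X₀ : Matrix (Fin 3) (Fin 3) K) * g) -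
      LinearMap.mulRight K (g⁻¹ * (X₀ : Matrix (Fin 3) (Fin 3) K) * g) : Module.End K (Matrix (Fin 3) (Fin 3) K))).restrictScalars ℚ) ↔
      (Z.map σ)ᵀ * diagonal (fun i => ι (d' i)) + diagonal (fun i => ι (d' i)) * Z = 0 ∧ diagonal ![a, a, b] * Z = Z * diagonal ![a, a, b] := by
    intro Z
    rw [Submodule.mem_inf, Submodule.restrictScalars_mem, LinearMap.mem_ker, LinearMap.sub_apply, LinearMap.mulLeft_apply, LinearMap.mulRight_apply,
      sub_eq_zero, h𝔲', hJ'd, hgX]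
  obtain ⟨U₁, hU₁, hU₁i⟩ := exists_nhds_setLIntegral_eta_rpow_lt_top_normalForm σ hσ hσc ι hι hιr hιn lam hlam h2F d' hd'0 hab _ h𝔠T μ𝔠' μF h2r
  -- ball form on the normal-form slice, with the opaque integrand
  have hpt : ∀ Z : Matrix (Fin 3) (Fin 3) K, η (g⁻¹ * (X₀ : Matrix (Fin 3) (Fin 3) K) * g + Z) =
      ((IsNonarchimedeanLocalField.normAbs K (Matrix.charpoly (diagonal ![a, a, b] + Z)).discr : ℝ≥0∞)) ^ (-r) := fun Z => by
    rw [hη, hgX]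
  have hball' : ∃ ρ : ℝ, 0 < ρ ∧ ∫⁻ Z in closedBall (0 : ↥(𝔲' ⊓ (LinearMap.ker (LinearMap.mulLeft K (g⁻¹ * (X₀ : Matrix (Fin 3) (Fin 3) K) * g) -
      LinearMap.mulRight K (g⁻¹ * (X₀ : Matrix (Fin 3) (Fin 3) K) * g) : Module.End K (Matrix (Fin 3) (Fin 3) K))).restrictScalars ℚ)) ρ,
      η (g⁻¹ * (X₀ : Matrix (Fin 3) (Fin 3) K) * g + (Z : Matrix (Fin 3) (Fin 3) K)) ∂μ𝔠' < ∞ := by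
    refine (exists_ball_iff_exists_nhds _ (fun U => ∫⁻ Z in U, η (g⁻¹ * (X₀ : Matrix (Fin 3) (Fin 3) K) * g + (Z : Matrix (Fin 3) (Fin 3) K)) ∂μ𝔠' < ∞)
      (fun s t hst ht => lt_of_le_of_lt (lintegral_mono_set hst) ht)).2 ⟨U₁, hU₁, ?_⟩
    simp_rw [hpt]
    exact hU₁i
  -- transport back to `𝔠_J(X₀)` (★ (ii-T)) and conclude by ★ file D
  have hball := (exists_ball_setLIntegral_lt_top_iff_conj σ hg rfl 𝔲ℚ 𝔲' h𝔲ℚ h𝔲' (X₀ : Matrix (Fin 3) (Fin 3) K) μ𝔠 μ𝔠' η hclass).2 hball'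
  have hD := exists_nhds_setLIntegral_lt_top_of_slice σ J hJd hσc 𝔲ℚ h𝔲ℚ hS hp hpS μ μ𝔠 η hgm hclass hball
  simp_rw [hη] at hD
  exact hD

/-! ## §4 HEAD: semisimple descent at a split-semisimple non-scalar point of `↥𝔲`, exponent `r` (twin of the first ★ FINAL head) -/

/-- **(ε3) HEAD — SEMISIMPLE DESCENT AT A SPLIT-SEMISIMPLE NON-REGULAR POINT OF `↥𝔲`, EXPONENT `r` WITH `12 r < 5`** (twin of the first ★ FINAL head
`F0P3cStCharTSHCDescentSemisimpleFinal.exists_nhds_setLIntegral_etaInv_lt_top_of_isSplitSemisimple`: binders VERBATIM, `{r : ℝ} (hr5 : 12 * r < 5)` inserted before `X₀`, token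
`((↑|disc χ_X|_K)) ^ (−r)`).  `σ` a continuous involution of the char-0 non-archimedean local field `K` with fixed field the closed-embedded local field `ι : F′ → K` (norm bridge),
`lam` a skew unit, `2 ≠ 0`; `J` `σ`-hermitian with `det J` a unit; `𝔲 = 𝔲(J)` with ANY Borel structure and ANY additive Haar `μ`.  If `X₀ ∈ 𝔲` is split semisimple non-scalar
(`∃ a ≠ b, (X₀ − a)(X₀ − b) = 0`, `X₀ ≠ c • 1` for all `c`), then `ηᵣ X = (↑|disc χ_X|_K)^(−r)` has finite `∫⁻` on a neighbourhood of `X₀` in `↥𝔲` (★ (ii-B) normal-form basis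
`exists_isUnit_conj_eq_diagonal_and_congr_diagonal` ∘ §3; only `2r < 1` is used). [cite: HarishChandra1970, Part VI Lemma 22; Part VII §1 Thm. 15] [cite: Rogawski1990, §3.6 pp. 28–31; §12.5 p. 184] -/
theorem exists_nhds_setLIntegral_eta_rpow_lt_top_of_isSplitSemisimple
    (σ : K →+* K) (hσ : ∀ x, σ (σ x) = x) (hσc : Continuous σ)
    {J : Matrix (Fin 3) (Fin 3) K} (hJσ : (J.map σ)ᵀ = J) (hJd : IsUnit J.det) (h2 : (2 : K) ≠ 0)
    (lam : Kˣ) (hlam : σ (lam : K) = -(lam : K))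
    (𝔲 : AddSubgroup (Matrix (Fin 3) (Fin 3) K)) (h𝔲 : ∀ X, X ∈ 𝔲 ↔ (X.map σ)ᵀ * J + J * X = 0)
    [MeasurableSpace ↥𝔲] [BorelSpace ↥𝔲] (μ : Measure ↥𝔲) [μ.IsAddHaarMeasure]
    {F' : Type*} [Field F'] [ValuativeRel F'] [TopologicalSpace F'] [IsNonarchimedeanLocalField F']
    (ι : F' →+* K) (hι : IsClosedEmbedding ι) (hιr : ∀ x, σ x = x ↔ x ∈ Set.range ι)
    (hιn : ∀ x : F', IsNonarchimedeanLocalField.normAbs K (ι x) = IsNonarchimedeanLocalField.normAbs F' x ^ 2)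
    {r : ℝ} (hr5 : 12 * r < 5)
    (X₀ : ↥𝔲)
    (hss : ∃ a b : K, a ≠ b ∧ ((X₀ : Matrix (Fin 3) (Fin 3) K) - a • (1 : Matrix (Fin 3) (Fin 3) K)) * ((X₀ : Matrix (Fin 3) (Fin 3) K) - b • 1) = 0 ∧
      ∀ c : K, (X₀ : Matrix (Fin 3) (Fin 3) K) ≠ c • 1) :
    ∃ U ∈ 𝓝 X₀, ∫⁻ X in U,
      ((IsNonarchimedeanLocalField.normAbs K (Matrix.charpoly (X : Matrix (Fin 3) (Fin 3) K)).discr : ℝ≥0∞)) ^ (-r) ∂μ < ∞ := by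
  obtain ⟨a, b, hab, hmin, hns⟩ := hss
  haveI : Invertible (2 : K) := invertibleOfNonzero h2
  have hS : ((X₀ : Matrix (Fin 3) (Fin 3) K).map σ)ᵀ * J + J * (X₀ : Matrix (Fin 3) (Fin 3) K) = 0 := (h𝔲 _).1 X₀.2
  obtain ⟨g, hg, hor, d, hd, hgJ⟩ := exists_isUnit_conj_eq_diagonal_and_congr_diagonal σ hσ hJσ hJd hS hab hmin hns
  rcases hor with h | h
  · exact exists_nhds_setLIntegral_eta_rpow_lt_top_of_normalFormBasis σ hσ hσc hJd h2 lam hlam 𝔲 h𝔲 μ ι hι hιr hιn hr5 X₀ hab hmin hg h hd hgJ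
  · refine exists_nhds_setLIntegral_eta_rpow_lt_top_of_normalFormBasis σ hσ hσc hJd h2 lam hlam 𝔲 h𝔲 μ ι hι hιr hιn hr5 X₀ hab.symm ?_ hg h hd hgJ
    rw [sub_smul_one_mul_sub_smul_one]; exact hmin

/-- **(ε3) at the ★ exponent — dictionary check**: the (T1) statement at `r = 1∕4` (token `(↑|disc χ_X|_K)^(−1∕4)`) DERIVED FROM the ★ head
`F0P3cStCharTSHCDescentSemisimpleFinal.exists_nhds_setLIntegral_etaInv_lt_top_of_isSplitSemisimple` by ★ `coe_rpow_neg_quarter` (typed in this direction because the gate's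
`dedup.landed` forbids restating the ★ head itself); it is also the `r = 1∕4`, `12 · ¼ = 3 < 5` instance of §4. [cite: HarishChandra1970, Part VII §1 Thm. 15] -/
theorem exists_nhds_setLIntegral_eta_rpow_quarter_lt_top_of_isSplitSemisimple
    (σ : K →+* K) (hσ : ∀ x, σ (σ x) = x) (hσc : Continuous σ)
    {J : Matrix (Fin 3) (Fin 3) K} (hJσ : (J.map σ)ᵀ = J) (hJd : IsUnit J.det) (h2 : (2 : K) ≠ 0)
    (lam : Kˣ) (hlam : σ (lam : K) = -(lam : K))
    (𝔲 : AddSubgroup (Matrix (Fin 3) (Fin 3) K)) (h𝔲 : ∀ X, X ∈ 𝔲 ↔ (X.map σ)ᵀ * J + J * X = 0)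
    [MeasurableSpace ↥𝔲] [BorelSpace ↥𝔲] (μ : Measure ↥𝔲) [μ.IsAddHaarMeasure]
    {F' : Type*} [Field F'] [ValuativeRel F'] [TopologicalSpace F'] [IsNonarchimedeanLocalField F']
    (ι : F' →+* K) (hι : IsClosedEmbedding ι) (hιr : ∀ x, σ x = x ↔ x ∈ Set.range ι)
    (hιn : ∀ x : F', IsNonarchimedeanLocalField.normAbs K (ι x) = IsNonarchimedeanLocalField.normAbs F' x ^ 2)
    (X₀ : ↥𝔲)
    (hss : ∃ a b : K, a ≠ b ∧ ((X₀ : Matrix (Fin 3) (Fin 3) K) - a • (1 : Matrix (Fin 3) (Fin 3) K)) * ((X₀ : Matrix (Fin 3) (Fin 3) K) - b • 1) = 0 ∧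
      ∀ c : K, (X₀ : Matrix (Fin 3) (Fin 3) K) ≠ c • 1) :
    ∃ U ∈ 𝓝 X₀, ∫⁻ X in U,
      ((IsNonarchimedeanLocalField.normAbs K (Matrix.charpoly (X : Matrix (Fin 3) (Fin 3) K)).discr : ℝ≥0∞)) ^ (-(1 / 4 : ℝ)) ∂μ < ∞ := by
  obtain ⟨U, hU, hfin⟩ := F0P3cStCharTSHCDescentSemisimpleFinal.exists_nhds_setLIntegral_etaInv_lt_top_of_isSplitSemisimple σ hσ hσc hJσ hJd h2 lam hlam 𝔲 h𝔲 μ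
    ι hι hιr hιn X₀ hss
  refine ⟨U, hU, ?_⟩
  simpa only [coe_rpow_neg_quarter] using hfin

/-! ## §5 SECOND HEAD: the `hss` binder of ★ (ε4) `…_of_reg_sq_ss`, on the trace-zero part `↥𝔲₀` (twin of the second ★ FINAL head) -/

/-- **(ε3) SECOND HEAD — THE `hss` BINDER OF ★ (ε4) `K2E3HCDLieGlobalRpow.forall_exists_nhds_setLIntegral_eta_rpow_lt_top_of_reg_sq_ss`, TOKEN FOR TOKEN** (twin of the
second ★ FINAL head `…Final.forall_exists_nhds_setLIntegral_etaInv_lt_top_traceZero_of_isSplitSemisimple`: binders VERBATIM, `{r : ℝ} (hr5 : 12 * r < 5)` appended, token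
`((↑|disc χ_X|_K)) ^ (−r)`).  On the trace-zero part `↥𝔲₀` (ANY Haar `μ₀`; an auxiliary Haar `μ` on `↥𝔲`, `3 ≠ 0`): at every split-semisimple non-scalar `X₀ ∈ 𝔲₀`, `ηᵣ` has
finite `∫⁻` on a neighbourhood of `X₀` in `↥𝔲₀` — §4 carried down by ★ (ε4)'s pointwise descent `exists_nhds_setLIntegral_eta_rpow_lt_top_traceZero_of_lie`.
[cite: HarishChandra1970, Part VII §1 Thm. 15] [cite: Folland1999, §11.1 Thm. 11.9] -/
theorem forall_exists_nhds_setLIntegral_eta_rpow_lt_top_traceZero_of_isSplitSemisimple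
    (σ : K →+* K) (hσ : ∀ x, σ (σ x) = x) (hσc : Continuous σ)
    {J : Matrix (Fin 3) (Fin 3) K} (hJσ : (J.map σ)ᵀ = J) (hJd : IsUnit J.det) (h2 : (2 : K) ≠ 0) (h3 : (3 : K) ≠ 0)
    (lam : Kˣ) (hlam : σ (lam : K) = -(lam : K))
    (𝔲 : AddSubgroup (Matrix (Fin 3) (Fin 3) K)) (h𝔲 : ∀ X, X ∈ 𝔲 ↔ (X.map σ)ᵀ * J + J * X = 0)
    (𝔲₀ : AddSubgroup (Matrix (Fin 3) (Fin 3) K)) (h𝔲₀ : ∀ X, X ∈ 𝔲₀ ↔ (X.map σ)ᵀ * J + J * X = 0 ∧ Matrix.trace X = 0)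
    [MeasurableSpace ↥𝔲₀] [BorelSpace ↥𝔲₀] (μ₀ : Measure ↥𝔲₀) [μ₀.IsAddHaarMeasure]
    [MeasurableSpace ↥𝔲] [BorelSpace ↥𝔲] (μ : Measure ↥𝔲) [μ.IsAddHaarMeasure]
    {F' : Type*} [Field F'] [ValuativeRel F'] [TopologicalSpace F'] [IsNonarchimedeanLocalField F']
    (ι : F' →+* K) (hι : IsClosedEmbedding ι) (hιr : ∀ x, σ x = x ↔ x ∈ Set.range ι)
    (hιn : ∀ x : F', IsNonarchimedeanLocalField.normAbs K (ι x) = IsNonarchimedeanLocalField.normAbs F' x ^ 2)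
    {r : ℝ} (hr5 : 12 * r < 5) :
    ∀ X₀ : ↥𝔲₀, (∃ a b : K, a ≠ b ∧ ((X₀ : Matrix (Fin 3) (Fin 3) K) - a • (1 : Matrix (Fin 3) (Fin 3) K)) * ((X₀ : Matrix (Fin 3) (Fin 3) K) - b • 1) = 0 ∧
        ∀ c : K, (X₀ : Matrix (Fin 3) (Fin 3) K) ≠ c • 1) →
      ∃ U ∈ 𝓝 X₀, ∫⁻ X in U,
        ((IsNonarchimedeanLocalField.normAbs K (Matrix.charpoly (X : Matrix (Fin 3) (Fin 3) K)).discr : ℝ≥0∞)) ^ (-r) ∂μ₀ < ∞ := by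
  intro X₀ hX₀
  exact exists_nhds_setLIntegral_eta_rpow_lt_top_traceZero_of_lie hσc hJd h3 𝔲 h𝔲 𝔲₀ h𝔲₀ μ₀ μ r X₀
    (exists_nhds_setLIntegral_eta_rpow_lt_top_of_isSplitSemisimple σ hσ hσc hJσ hJd h2 lam hlam 𝔲 h𝔲 μ ι hι hιr hιn hr5 _ hX₀)

end Assembly

end Summit.HodgeConjecture.HodgeConjecture.Cruxes.H413.K2E3HCDescentSemisimpleRpow

end
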